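import Mathlib
import Summits.QuantumFields.QCD.Theorems.QuarksAsStableActionUnquenchedChessboardBoundStubMarginalRPGram
import HarnessLib

/-!
# Link Gram identity, part 2: the mirrored block determinant is a Gram sum
(crux stmt-QuantumFields-9735, line `Sketch`, lead's stub `linkGram`)

Pure matrix algebra. In the temporal gauge and the chiral spin basis, the Wilson–Dirac matrix of a
link-reflection-symmetric slab has the block form `[[P, J₁], [J₂, Q]]` (lower, upper halves) with
DIAGONAL couplings `J₁ = diag d₁`, `J₂ = diag d₂` (`d₁ = -𝟙[t = 1, lower chirality]`,
`d₂ = -𝟙[t = 1, upper chirality]`, from `P₋ = diag(0,0,1,1)`, `P₊ = diag(1,1,0,0)`) and the mirror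
relation `P = Γ₀ Q̃ᴴ Γ₀` (`Γ₀ = diag ε`, `ε = ±1`, `ε = +1` where `d₂ ≠ 0`, `ε = -1` where `d₁ ≠ 0`;
`Q̃` the upper block of the reflected field). `det_fromBlocks_mirror_gram`: then

  `det [[Γ₀ Q̃ᴴ Γ₀, diag d₁], [diag d₂, Q]] = Σ_{S,T} w(S,T) · ρ(Q)_{S,T} · conj ρ(Q̃)_{S,T}`,

`w(S,T) = 𝟙[|S| = |T|, d₁ ≠ 0 on S, d₂ ≠ 0 on T] ∈ {0, 1}` — a GRAM pairing of the row-replacement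
determinants (`rho`) of `Q` and `Q̃` with non-negative weights (all signs `+`). From the tree's
`det_fromBlocks_eq_sum_rho`, `Gamma_diagonal`, `rho_diagonal_mul_mul_diagonal`, `rho_conjTranspose`.
All statements are proved.
-/

noncomputable section

open Matrix Complex Finset
open Literature.MathematicalPhysics.QuantumLattice
open scoped ComplexConjugate BigOperators

namespace Summit.QuantumFields.QCD.Theorems.UnquenchedChessboardBoundLine

variable {n : ℕ}

/-- Collapsing the two inner sums of the block expansion against diagonal couplings:
`Σ_{W,Z,T} a_{S,T} Γ(diag d₂)_{T,Z} b_{Z,W} Γ(diag d₁)_{W,S} = Σ_T a_{S,T} (∏_T d₂) b_{T,S} (∏_S d₁)`. -/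
theorem sum_gamma_diagonal_collapse (a b : Finset (Fin n) → Finset (Fin n) → ℂ) (d₁ d₂ : Fin n → ℂ)
    (S : Finset (Fin n)) :
    ∑ W : Finset (Fin n), ∑ Z : Finset (Fin n), ∑ T : Finset (Fin n),
        a S T * Gamma (diagonal d₂) T Z * b Z W * Gamma (diagonal d₁) W S =
      ∑ T : Finset (Fin n), a S T * (∏ i ∈ T, d₂ i) * b T S * (∏ i ∈ S, d₁ i) := by
  have hZ : ∀ W : Finset (Fin n), ∑ Z : Finset (Fin n), ∑ T : Finset (Fin n),
      a S T * Gamma (diagonal d₂) T Z * b Z W * Gamma (diagonal d₁) W S =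
      ∑ T : Finset (Fin n), a S T * (∏ i ∈ T, d₂ i) * b T W * Gamma (diagonal d₁) W S := by
    intro W
    rw [Finset.sum_comm]
    refine Finset.sum_congr rfl fun T _ => ?_
    simp_rw [Gamma_diagonal]
    rw [Finset.sum_eq_single T]
    · rw [if_pos rfl]
    · intro Z _ hZT
      rw [if_neg (Ne.symm hZT), mul_zero, zero_mul, zero_mul]
    · intro h; exact absurd (Finset.mem_univ T) h
  simp_rw [hZ]
  rw [Finset.sum_comm]
  refine Finset.sum_congr rfl fun T _ => ?_
  simp_rw [Gamma_diagonal]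
  rw [Finset.sum_eq_single S]
  · rw [if_pos rfl]
  · intro W _ hWS
    rw [if_neg hWS, mul_zero]
  · intro h; exact absurd (Finset.mem_univ S) h

/-- `(∏ ε)² = 1` for signs `ε = ±1`. -/
theorem prod_sign_mul_self (ε : Fin n → ℂ) (hε : ∀ i, ε i = 1 ∨ ε i = -1) :
    (∏ i, ε i) * ∏ i, ε i = 1 := by
  rw [← Finset.prod_mul_distrib]
  refine Finset.prod_eq_one fun i _ => ?_
  rcases hε i with h | h <;> simp [h]

/-- **The mirrored block determinant is a Gram sum.** See the module docstring. -/
theorem det_fromBlocks_mirror_gram (Q Qt : Matrix (Fin n) (Fin n) ℂ) (ε d₁ d₂ : Fin n → ℂ)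
    (hε : ∀ i, ε i = 1 ∨ ε i = -1) (hd₁ : ∀ i, d₁ i = 0 ∨ (d₁ i = -1 ∧ ε i = -1))
    (hd₂ : ∀ i, d₂ i = 0 ∨ (d₂ i = -1 ∧ ε i = 1)) :
    (fromBlocks (diagonal ε * Qtᴴ * diagonal ε) (diagonal d₁) (diagonal d₂) Q).det =
      ∑ S : Finset (Fin n), ∑ T : Finset (Fin n),
        (if S.card = T.card ∧ (∀ i ∈ S, d₁ i ≠ 0) ∧ (∀ i ∈ T, d₂ i ≠ 0) then (1 : ℂ) else 0) *
          (rho Q S T * conj (rho Qt S T)) := by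
  have hε0 : ∀ i, ε i ≠ 0 := fun i => by rcases hε i with h | h <;> simp [h]
  have hεinv : ∀ i, (ε i)⁻¹ = ε i := fun i => by rcases hε i with h | h <;> simp [h]
  rw [det_fromBlocks_eq_sum_rho]
  refine Finset.sum_congr rfl fun S _ => ?_
  rw [sum_gamma_diagonal_collapse (fun S T => (-1) ^ S.card * rho Q S T)
    (fun Z W => rho (diagonal ε * Qtᴴ * diagonal ε) Z W) d₁ d₂ S]
  refine Finset.sum_congr rfl fun T _ => ?_
  rw [rho_diagonal_mul_mul_diagonal ε ε hε0 hε0, rho_conjTranspose, prod_sign_mul_self ε hε,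
    one_mul]
  simp_rw [hεinv]
  -- the sign computation
  by_cases hc : S.card = T.card
  swap
  · rw [rho_of_card_ne hc, if_neg (fun h => hc h.1)]
    simp
  by_cases h₁ : ∀ i ∈ S, d₁ i ≠ 0
  swap
  · push Not at h₁
    obtain ⟨i, hi, hi0⟩ := h₁
    rw [Finset.prod_eq_zero hi hi0, if_neg (fun h => h.2.1 i hi hi0)]
    simp
  by_cases h₂ : ∀ i ∈ T, d₂ i ≠ 0
  swap
  · push Not at h₂
    obtain ⟨i, hi, hi0⟩ := h₂
    rw [Finset.prod_eq_zero hi hi0, if_neg (fun h => h.2.2 i hi hi0)]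
    simp
  rw [if_pos ⟨hc, h₁, h₂⟩, one_mul]
  have hS₁ : ∏ i ∈ S, d₁ i = (-1) ^ S.card := by
    rw [Finset.prod_eq_pow_card]
    intro i hi
    rcases hd₁ i with h | h
    · exact absurd h (h₁ i hi)
    · exact h.1
  have hT₂ : ∏ i ∈ T, d₂ i = (-1) ^ T.card := by
    rw [Finset.prod_eq_pow_card]
    intro i hi
    rcases hd₂ i with h | h
    · exact absurd h (h₂ i hi)
    · exact h.1
  have hSε : ∏ i ∈ S, ε i = (-1) ^ S.card := by
    rw [Finset.prod_eq_pow_card]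
    intro i hi
    rcases hd₁ i with h | h
    · exact absurd h (h₁ i hi)
    · exact h.2
  have hTε : ∏ i ∈ T, ε i = 1 := by
    refine Finset.prod_eq_one fun i hi => ?_
    rcases hd₂ i with h | h
    · exact absurd h (h₂ i hi)
    · exact h.2
  rw [hS₁, hT₂, hSε, hTε, hc]
  have h2 : ((-1 : ℂ) ^ T.card) * (-1) ^ T.card = 1 := by
    rw [← pow_add, ← two_mul, pow_mul]
    simp
  linear_combination (rho Q S T * conj (rho Qt S T)) * (((-1 : ℂ) ^ T.card) * (-1) ^ T.card + 1) * h2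

end Summit.QuantumFields.QCD.Theorems.UnquenchedChessboardBoundLine

end
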